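import Mathlib
import HarnessLib
import Summits.Ventures.LatticeQCDFlow.Exactness.SU2WilsonFlowLOExactForceRegular
import Summits.Ventures.LatticeQCDFlow.Exactness.SU2MultiStepLeapfrogHMC

/-!
# `SU(2)` rung — the Pauli drift `e_ε(p)·V` moves a configuration by at most `8|ε|‖p‖` in the matrix sup norm; THE WORK IDENTITY for ANY action along the drift, `d/dt S(e_ε(tp)·V) = Σ_l ⟪D^ε S(e_ε(tp)·V)_l, p_l⟫`, and first-order Taylor with the explicit remainder `4|ε|K‖p‖Σ_l‖p_l‖`

HONEST FRAMING: exact (Metropolis-corrected) sampling algorithms for lattice gauge theory;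
figures of merit are autocorrelation/cost numbers at stated couplings and volumes; no
continuum-physics claim.

Venture `LatticeQCDFlow` (cell pub-lqcd), topic `Exactness`; FANOUT row 14 (`eng-flowhmc`, engine
`latflow.fthmc`, family B: the leapfrog drift `U_l ← expm(ε P_l) U_l` between two half kicks by the
autodiff force).  The `SU(2)` twin of `U1ExactForceWork` for an ARBITRARY action, and the input of
`SU2LeapfrogEnergyError` (the energy error of the engine's `n`-step `SU(2)` proposal).  NEW WORK of the cell
over the tree: row 9's kernel of record `SU2MultiStepLeapfrogHMC` (`su2ExpDrift ε p = (exp(iε p_l·σ))_l`),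
`SUNProductTrajectory` (`coeConfig`, `‖U‖_{∞-op} ≤ N` on `SU(N)`), `SU2WilsonFlowLOExactForceRegular` §2
(`clm_pi_euclidean_eq_sum_inner`), Literature `B10Eq18SigmaSU2.su2Coord`, `B10Eq18SigmaSU2Haar.expPauli`,
`B10Eq18SigmaSU2Chart.su2Coord_add/_smul`, Mathlib (`hasDerivAt_exp_smul_const`, the mean value inequality,
`Matrix.linfty_opNorm_def`); nothing is cited as a fact; no number.  `S : (ι → SU(2)) → ℝ` is ARBITRARY (any
finite link set `ι`; the FT action `β S_W∘F − log J` of any member, or `β S_W`); its COORDINATE GRADIENT along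
the drift is `D^ε S(W)_l = (∂_{a_l^i} S(e_ε(a)·W)|_{a=0})_i ∈ ℝ³`; the tree's exact force is `Φ_κ = κ·D¹S̃`
(`SU2WilsonFlowLOExactForceRegular`), typed Lipschitz in exactly the matrix sup norm `‖coeConfig W − coeConfig W'‖`
used here.

* §1 `su2ExpDrift_zero`, **`su2ExpDrift_add_smul`** (`e_ε((h+s)p) = e_ε(hp)·e_ε(sp)`: the drift is a
  one-parameter group linkwise), **`linfty_opNorm_su2Coord_le`** (`‖iΣ_a x_aσ_a‖_{∞-op} ≤ 2‖x‖`),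
  `norm_coe_su2_le`, `hasDerivAt_coe_expPauli_smul` (`d/dτ exp(iτ a·σ) = exp(iτ a·σ)·(i a·σ)`),
  **`norm_coe_expPauli_smul_sub_le`** (`‖exp(it a·σ) − exp(it' a·σ)‖_{∞-op} ≤ 4‖a‖|t − t'|`),
  **`norm_coeConfig_su2ExpDrift_sub_le`** — `‖coeConfig(e_ε(tp)·V) − coeConfig(e_ε(t'p)·V)‖ ≤ 8|ε|‖p‖|t − t'|`
  (the constant `8 = 2·2·2` from `‖U‖_{∞-op} ≤ 2` twice and `‖i x·σ‖_{∞-op} ≤ 2‖x‖`; not optimised — the `L²`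
  operator norm would give `|ε|‖p‖|t − t'|`);
* §2 **`fderiv_action_su2ExpDrift_eq_sum_inner`** — the coordinate gradient IS the differential:
  `D(a ↦ S(e_ε(a)·V))(0)[δ] = Σ_l ⟪D^ε S(V)_l, δ_l⟫` (linearity only; what reverse-mode autodiff returns is
  this vector); **`hasDerivAt_action_su2ExpDrift`** — THE WORK IDENTITY: if `a ↦ S(e_ε(a)·W)` is differentiable
  at `0` for every `W`, then `d/dt|_{t=s} S(e_ε(tp)·V) = Σ_l ⟪D^ε S(e_ε(sp)·V)_l, p_l⟫` (group law + chain rule at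
  the current configuration); `abs_action_su2ExpDrift_sub_le` — mean value: `‖D^ε S‖ ≤ D_max` linkwise gives
  `|S(e_ε(p)·V) − S(V)| ≤ D_max·Σ_l‖p_l‖`; **`abs_action_su2ExpDrift_sub_linear_le`** — FIRST-ORDER TAYLOR WITH AN
  EXPLICIT SECOND-ORDER REMAINDER: `‖D^ε S(W) − D^ε S(W')‖ ≤ K‖coeConfig W − coeConfig W'‖` gives
  `|S(e_ε(p)·V) − S(V) − Σ_l ⟪D^ε S(V)_l, p_l⟫| ≤ 4|ε|·K·‖p‖·Σ_l‖p_l‖` — over one leapfrog drift the potential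
  deviates from its linearisation by `O(ε²)` once `K = O(ε)` (`D^ε S̃ = (ε/κ)Φ_κ`).

NOT CLAIMED: optimal constants; the `L²`-operator-norm version; anything when `a ↦ S(e_ε(a)·W)` is not
differentiable (LeakyReLU conditioners); floating point; any number.
-/

noncomputable section

namespace Summit.Ventures.LatticeQCDFlow.Exactness

open Set Function MeasureTheory NormedSpace
open Literature.MathematicalPhysics.QuantumFieldTheory
open Literature.MathematicalPhysics.QuantumFieldTheory.Balaban1983to89.B10Eq18SigmaSU2 (su2Coord)
open Literature.MathematicalPhysics.QuantumFieldTheory.Balaban1983to89.B10Eq18SigmaSU2Haar (expPauli expPauli_zero coe_expPauli)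
open Literature.MathematicalPhysics.QuantumFieldTheory.Balaban1983to89.B10Eq18SigmaSU2Chart (su2Coord_add su2Coord_smul)
open scoped Matrix Matrix.Norms.Operator InnerProductSpace

set_option backward.isDefEq.respectTransparency false

variable {ι : Type*}

/-! ## §1 The Pauli drift: group law, and how far it moves a configuration in the matrix sup norm -/

section Drift

/-- `e_ε(0) = 1`. -/
theorem su2ExpDrift_zero (ε : ℝ) : su2ExpDrift ε (0 : ι → EuclideanSpace ℝ (Fin 3)) = 1 := by
  funext l
  simp only [su2ExpDrift_apply, Pi.zero_apply, smul_zero, expPauli_zero, Pi.one_apply]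

/-- **The drift is a one-parameter group linkwise**: `e_ε((h+s)p) = e_ε(hp)·e_ε(sp)`. -/
theorem su2ExpDrift_add_smul (ε : ℝ) (p : ι → EuclideanSpace ℝ (Fin 3)) (h s : ℝ) :
    su2ExpDrift ε ((h + s) • p) = su2ExpDrift ε (h • p) * su2ExpDrift ε (s • p) := by
  funext l
  simp only [su2ExpDrift_apply, Pi.mul_apply, Pi.smul_apply]
  rw [smul_comm ε (h + s) (p l), smul_comm ε h (p l), smul_comm ε s (p l)]
  -- parallel exponents commute (the same computation as `SU2ExactForceWork.expPauli_add_smul`)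
  apply Subtype.ext
  rw [WilsonFlow.coe_mul_SU, coe_expPauli, coe_expPauli, coe_expPauli]
  simp only [add_smul, WithLp.ofLp_add, WithLp.ofLp_smul, su2Coord_add, su2Coord_smul]
  exact Matrix.exp_add_of_commute _ _ (((Commute.refl _).smul_left h).smul_right s)

/-- **The Pauli coordinates in the `L∞` operator norm**: `‖iΣ_a x_aσ_a‖ ≤ 2‖x‖` (each entry has modulus
`≤ ‖x‖`, two entries per row). -/
theorem linfty_opNorm_su2Coord_le (x : EuclideanSpace ℝ (Fin 3)) : ‖su2Coord x‖ ≤ 2 * ‖x‖ := by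
  have hx : ∀ i, |x i| ≤ ‖x‖ := fun i => by
    have h := PiLp.norm_apply_le x i
    rwa [Real.norm_eq_abs] at h
  have h01 : ‖(x 0 : ℂ) * Complex.I + (x 1 : ℂ)‖ ≤ ‖x‖ ∧ ‖(x 0 : ℂ) * Complex.I - (x 1 : ℂ)‖ ≤ ‖x‖ := by
    have hn : ‖x‖ = Real.sqrt (x 0 ^ 2 + x 1 ^ 2 + x 2 ^ 2) := by
      rw [EuclideanSpace.norm_eq, Fin.sum_univ_three]
      simp only [Real.norm_eq_abs, sq_abs]
    have hle : Real.sqrt (x 1 ^ 2 + x 0 ^ 2) ≤ ‖x‖ := by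
      rw [hn]
      exact Real.sqrt_le_sqrt (by nlinarith [sq_nonneg (x 2)])
    constructor
    · rw [add_comm, Complex.norm_add_mul_I]
      exact hle
    · rw [show (x 0 : ℂ) * Complex.I - (x 1 : ℂ) = ((-(x 1) : ℝ) : ℂ) + (x 0 : ℂ) * Complex.I by push_cast; ring,
        Complex.norm_add_mul_I, neg_sq]
      exact hle
  have h2 : ‖(x 2 : ℂ) * Complex.I‖ ≤ ‖x‖ := by
    rw [norm_mul, Complex.norm_I, mul_one, Complex.norm_real, Real.norm_eq_abs]
    exact hx 2
  have e00 : su2Coord x 0 0 = (x 2 : ℂ) * Complex.I := rfl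
  have e01 : su2Coord x 0 1 = (x 0 : ℂ) * Complex.I + (x 1 : ℂ) := rfl
  have e10 : su2Coord x 1 0 = (x 0 : ℂ) * Complex.I - (x 1 : ℂ) := rfl
  have e11 : su2Coord x 1 1 = -((x 2 : ℂ) * Complex.I) := rfl
  have hrow : ∀ i : Fin 2, ∑ j : Fin 2, ‖su2Coord x i j‖ ≤ 2 * ‖x‖ := by
    intro i
    rw [Fin.sum_univ_two]
    fin_cases i
    · simp only [Fin.zero_eta, Fin.isValue, e00, e01]
      linarith [h01.1, h2]
    · simp only [Fin.mk_one, Fin.isValue, e10, e11, norm_neg]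
      linarith [h01.2, h2]
  rw [Matrix.linfty_opNorm_def]
  have h : ((Finset.univ : Finset (Fin 2)).sup fun i : Fin 2 => ∑ j : Fin 2, ‖su2Coord x i j‖₊) ≤ ⟨2 * ‖x‖, by positivity⟩ := by
    refine Finset.sup_le fun i _ => ?_
    rw [← NNReal.coe_le_coe, NNReal.coe_sum]
    simp only [coe_nnnorm]
    exact hrow i
  exact_mod_cast h

/-- A special unitary `2×2` matrix has `L∞` operator norm at most `2`. -/
theorem norm_coe_su2_le (U : Matrix.specialUnitaryGroup (Fin 2) ℂ) : ‖(U : Matrix (Fin 2) (Fin 2) ℂ)‖ ≤ 2 := by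
  have h := norm_le_card_of_mem_specialUnitaryGroup U.2
  simpa using h

/-- Along `τ ↦ exp(iτ a·σ)` the derivative is `exp(iτ a·σ)·(i a·σ)`. -/
theorem hasDerivAt_coe_expPauli_smul (a : EuclideanSpace ℝ (Fin 3)) (τ : ℝ) :
    HasDerivAt (fun τ : ℝ => ((expPauli (τ • a) : Matrix.specialUnitaryGroup (Fin 2) ℂ) : Matrix (Fin 2) (Fin 2) ℂ))
      (((expPauli (τ • a) : Matrix.specialUnitaryGroup (Fin 2) ℂ) : Matrix (Fin 2) (Fin 2) ℂ) * su2Coord a) τ := by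
  have hfun : (fun τ : ℝ => ((expPauli (τ • a) : Matrix.specialUnitaryGroup (Fin 2) ℂ) : Matrix (Fin 2) (Fin 2) ℂ)) =
      fun τ : ℝ => exp (τ • su2Coord a) := by
    funext τ
    rw [coe_expPauli, WithLp.ofLp_smul, su2Coord_smul]
  rw [hfun, coe_expPauli, WithLp.ofLp_smul, su2Coord_smul]
  exact hasDerivAt_exp_smul_const (𝕂 := ℝ) (su2Coord a) τ

/-- **One link moves by at most `4‖a‖·|t − t'|`**: `‖exp(it a·σ) − exp(it' a·σ)‖ ≤ 4‖a‖|t − t'|`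
(`L∞` operator norm; mean value along the one-parameter group). -/
theorem norm_coe_expPauli_smul_sub_le (a : EuclideanSpace ℝ (Fin 3)) (t t' : ℝ) :
    ‖((expPauli (t • a) : Matrix.specialUnitaryGroup (Fin 2) ℂ) : Matrix (Fin 2) (Fin 2) ℂ) -
        ((expPauli (t' • a) : Matrix.specialUnitaryGroup (Fin 2) ℂ) : Matrix (Fin 2) (Fin 2) ℂ)‖ ≤ 4 * ‖a‖ * |t - t'| := by
  have hderiv : ∀ τ ∈ segment ℝ t' t, HasDerivWithinAt
      (fun τ : ℝ => ((expPauli (τ • a) : Matrix.specialUnitaryGroup (Fin 2) ℂ) : Matrix (Fin 2) (Fin 2) ℂ))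
      (((expPauli (τ • a) : Matrix.specialUnitaryGroup (Fin 2) ℂ) : Matrix (Fin 2) (Fin 2) ℂ) * su2Coord a) (segment ℝ t' t) τ :=
    fun τ _ => (hasDerivAt_coe_expPauli_smul a τ).hasDerivWithinAt
  have hbound : ∀ τ ∈ segment ℝ t' t,
      ‖((expPauli (τ • a) : Matrix.specialUnitaryGroup (Fin 2) ℂ) : Matrix (Fin 2) (Fin 2) ℂ) * su2Coord a‖ ≤ 4 * ‖a‖ := by
    intro τ _
    calc ‖((expPauli (τ • a) : Matrix.specialUnitaryGroup (Fin 2) ℂ) : Matrix (Fin 2) (Fin 2) ℂ) * su2Coord a‖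
        ≤ ‖((expPauli (τ • a) : Matrix.specialUnitaryGroup (Fin 2) ℂ) : Matrix (Fin 2) (Fin 2) ℂ)‖ * ‖su2Coord a‖ := norm_mul_le _ _
      _ ≤ 2 * (2 * ‖a‖) := mul_le_mul (norm_coe_su2_le _) (linfty_opNorm_su2Coord_le a) (norm_nonneg _) (by norm_num)
      _ = 4 * ‖a‖ := by ring
  have h := Convex.norm_image_sub_le_of_norm_hasDerivWithin_le hderiv hbound (convex_segment t' t)
    (left_mem_segment ℝ t' t) (right_mem_segment ℝ t' t)
  calc _ ≤ 4 * ‖a‖ * ‖t - t'‖ := h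
    _ = 4 * ‖a‖ * |t - t'| := by rw [Real.norm_eq_abs]

variable [Fintype ι]

/-- **THE DRIFT MOVES A CONFIGURATION BY AT MOST `8|ε|·‖p‖·|t − t'|` IN THE MATRIX SUP NORM**:
`‖coeConfig (e_ε(tp)·V) − coeConfig (e_ε(t'p)·V)‖ ≤ 8|ε|‖p‖|t − t'|`. -/
theorem norm_coeConfig_su2ExpDrift_sub_le (ε : ℝ) (V : ι → Matrix.specialUnitaryGroup (Fin 2) ℂ)
    (p : ι → EuclideanSpace ℝ (Fin 3)) (t t' : ℝ) :
    ‖coeConfig (su2ExpDrift ε (t • p) * V) - coeConfig (su2ExpDrift ε (t' • p) * V)‖ ≤ 8 * |ε| * ‖p‖ * |t - t'| := by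
  refine (pi_norm_le_iff_of_nonneg (by positivity)).2 fun l => ?_
  rw [Pi.sub_apply, coeConfig_apply, coeConfig_apply, Pi.mul_apply, Pi.mul_apply, su2ExpDrift_apply, su2ExpDrift_apply,
    Pi.smul_apply, Pi.smul_apply, smul_comm ε t (p l), smul_comm ε t' (p l)]
  rw [WilsonFlow.coe_mul_SU, WilsonFlow.coe_mul_SU, ← sub_mul]
  have hp : ‖ε • p l‖ ≤ |ε| * ‖p‖ := by
    rw [norm_smul, Real.norm_eq_abs]
    exact mul_le_mul_of_nonneg_left (norm_le_pi_norm p l) (abs_nonneg ε)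
  calc ‖(((expPauli (t • ε • p l) : Matrix.specialUnitaryGroup (Fin 2) ℂ) : Matrix (Fin 2) (Fin 2) ℂ) -
          ((expPauli (t' • ε • p l) : Matrix.specialUnitaryGroup (Fin 2) ℂ) : Matrix (Fin 2) (Fin 2) ℂ)) * ((V l : Matrix.specialUnitaryGroup (Fin 2) ℂ) : Matrix (Fin 2) (Fin 2) ℂ)‖
      ≤ ‖((expPauli (t • ε • p l) : Matrix.specialUnitaryGroup (Fin 2) ℂ) : Matrix (Fin 2) (Fin 2) ℂ) -
          ((expPauli (t' • ε • p l) : Matrix.specialUnitaryGroup (Fin 2) ℂ) : Matrix (Fin 2) (Fin 2) ℂ)‖ * ‖((V l : Matrix.specialUnitaryGroup (Fin 2) ℂ) : Matrix (Fin 2) (Fin 2) ℂ)‖ := norm_mul_le _ _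
    _ ≤ (4 * ‖ε • p l‖ * |t - t'|) * 2 := mul_le_mul (norm_coe_expPauli_smul_sub_le _ t t') (norm_coe_su2_le _) (norm_nonneg _) (by positivity)
    _ ≤ (4 * (|ε| * ‖p‖) * |t - t'|) * 2 := by gcongr
    _ = 8 * |ε| * ‖p‖ * |t - t'| := by ring

end Drift

/-! ## §2 The coordinate gradient of `a ↦ S(e_ε(a)·V)` at `a = 0`: it is the differential; the work identity along the drift; mean-value and first-order Taylor bounds -/

section Work

variable [Fintype ι] [DecidableEq ι]

/-- **THE COORDINATE GRADIENT IS THE DIFFERENTIAL**: `D(a ↦ S(e_ε(a)·V))(0)[δ] = Σ_l ⟪D^ε S(V)_l, δ_l⟫` with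
`D^ε S(V)_l = (∂_{a_l^i} S(e_ε(a)·V)|₀)_i ∈ ℝ³` (linearity only). -/
theorem fderiv_action_su2ExpDrift_eq_sum_inner (S : (ι → Matrix.specialUnitaryGroup (Fin 2) ℂ) → ℝ) (ε : ℝ)
    (V : ι → Matrix.specialUnitaryGroup (Fin 2) ℂ) (δ : ι → EuclideanSpace ℝ (Fin 3)) :
    fderiv ℝ (fun a : ι → EuclideanSpace ℝ (Fin 3) => S (su2ExpDrift ε a * V)) 0 δ =
      ∑ l, ⟪WithLp.toLp 2 (fun i : Fin 3 => fderiv ℝ (fun a : ι → EuclideanSpace ℝ (Fin 3) => S (su2ExpDrift ε a * V)) 0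
        (Pi.single l (EuclideanSpace.single i (1 : ℝ)))), δ l⟫_ℝ :=
  clm_pi_euclidean_eq_sum_inner _ δ

/-- **THE WORK IDENTITY along the Pauli drift, for ANY action**: if `a ↦ S(e_ε(a)·W)` is differentiable at
`0` for every `W`, then `d/dt|_{t=s} S(e_ε(tp)·V) = Σ_l ⟪D^ε S(e_ε(sp)·V)_l, p_l⟫`. -/
theorem hasDerivAt_action_su2ExpDrift (S : (ι → Matrix.specialUnitaryGroup (Fin 2) ℂ) → ℝ) (ε : ℝ)
    (hd : ∀ W : ι → Matrix.specialUnitaryGroup (Fin 2) ℂ,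
      DifferentiableAt ℝ (fun a : ι → EuclideanSpace ℝ (Fin 3) => S (su2ExpDrift ε a * W)) 0)
    (V : ι → Matrix.specialUnitaryGroup (Fin 2) ℂ) (p : ι → EuclideanSpace ℝ (Fin 3)) (s : ℝ) :
    HasDerivAt (fun t : ℝ => S (su2ExpDrift ε (t • p) * V))
      (∑ l, ⟪WithLp.toLp 2 (fun i : Fin 3 => fderiv ℝ (fun a : ι → EuclideanSpace ℝ (Fin 3) =>
          S (su2ExpDrift ε a * (su2ExpDrift ε (s • p) * V))) 0 (Pi.single l (EuclideanSpace.single i (1 : ℝ)))), p l⟫_ℝ) s := by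
  -- chain rule at the current configuration `W = e_ε(sp)·V`
  have hinner : HasDerivAt (fun t : ℝ => (t - s) • p) p s := by
    simpa using ((hasDerivAt_id s).sub_const s).smul_const p
  have h0 : (fun t : ℝ => (t - s) • p) s = 0 := by simp
  have hG : HasFDerivAt (fun a : ι → EuclideanSpace ℝ (Fin 3) => S (su2ExpDrift ε a * (su2ExpDrift ε (s • p) * V)))
      (fderiv ℝ (fun a : ι → EuclideanSpace ℝ (Fin 3) => S (su2ExpDrift ε a * (su2ExpDrift ε (s • p) * V))) 0)
      ((fun t : ℝ => (t - s) • p) s) := by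
    rw [h0]
    exact (hd _).hasFDerivAt
  have hfin := hG.comp_hasDerivAt s hinner
  rw [fderiv_action_su2ExpDrift_eq_sum_inner S ε _ p] at hfin
  have hfeq : (fun t : ℝ => S (su2ExpDrift ε (t • p) * V)) =
      (fun a : ι → EuclideanSpace ℝ (Fin 3) => S (su2ExpDrift ε a * (su2ExpDrift ε (s • p) * V))) ∘ fun t : ℝ => (t - s) • p := by
    funext t
    simp only [Function.comp_apply]
    rw [← mul_assoc, ← su2ExpDrift_add_smul ε p (t - s) s, sub_add_cancel]
  rw [hfeq]
  exact hfin

/-- **THE MEAN-VALUE BOUND ALONG A DRIFT**: with `‖D^ε S(W)_l‖ ≤ D_max` for all `W, l`,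
`|S(e_ε(p)·V) − S(V)| ≤ D_max · Σ_l ‖p_l‖`. -/
theorem abs_action_su2ExpDrift_sub_le (S : (ι → Matrix.specialUnitaryGroup (Fin 2) ℂ) → ℝ) (ε : ℝ)
    (hd : ∀ W : ι → Matrix.specialUnitaryGroup (Fin 2) ℂ,
      DifferentiableAt ℝ (fun a : ι → EuclideanSpace ℝ (Fin 3) => S (su2ExpDrift ε a * W)) 0)
    {Dmax : ℝ} (hDb : ∀ (W : ι → Matrix.specialUnitaryGroup (Fin 2) ℂ) (l : ι),
      ‖WithLp.toLp 2 (fun i : Fin 3 => fderiv ℝ (fun a : ι → EuclideanSpace ℝ (Fin 3) => S (su2ExpDrift ε a * W)) 0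
        (Pi.single l (EuclideanSpace.single i (1 : ℝ))))‖ ≤ Dmax)
    (V : ι → Matrix.specialUnitaryGroup (Fin 2) ℂ) (p : ι → EuclideanSpace ℝ (Fin 3)) :
    |S (su2ExpDrift ε p * V) - S V| ≤ Dmax * ∑ l, ‖p l‖ := by
  have hderiv : ∀ t ∈ Icc (0 : ℝ) 1, HasDerivWithinAt (fun t : ℝ => S (su2ExpDrift ε (t • p) * V))
      ((fun t : ℝ => ∑ l, ⟪WithLp.toLp 2 (fun i : Fin 3 => fderiv ℝ (fun a : ι → EuclideanSpace ℝ (Fin 3) =>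
          S (su2ExpDrift ε a * (su2ExpDrift ε (t • p) * V))) 0 (Pi.single l (EuclideanSpace.single i (1 : ℝ)))), p l⟫_ℝ) t)
        (Icc (0 : ℝ) 1) t :=
    fun t _ => (hasDerivAt_action_su2ExpDrift S ε hd V p t).hasDerivWithinAt
  have hbound : ∀ t ∈ Ico (0 : ℝ) 1, ‖(fun t : ℝ => ∑ l, ⟪WithLp.toLp 2 (fun i : Fin 3 => fderiv ℝ (fun a : ι → EuclideanSpace ℝ (Fin 3) =>
          S (su2ExpDrift ε a * (su2ExpDrift ε (t • p) * V))) 0 (Pi.single l (EuclideanSpace.single i (1 : ℝ)))), p l⟫_ℝ) t‖ ≤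
        Dmax * ∑ l, ‖p l‖ := by
    intro t _
    refine (norm_sum_le _ _).trans ?_
    rw [Finset.mul_sum]
    refine Finset.sum_le_sum fun l _ => ?_
    exact (norm_inner_le_norm _ _).trans (mul_le_mul_of_nonneg_right (hDb _ l) (norm_nonneg _))
  have h := norm_image_sub_le_of_norm_deriv_le_segment' hderiv hbound 1 (right_mem_Icc.2 zero_le_one)
  simp only [one_smul, zero_smul, su2ExpDrift_zero, one_mul, sub_zero, mul_one] at h
  rw [Real.norm_eq_abs] at h
  exact h

/-- **FIRST-ORDER TAYLOR ALONG THE DRIFT WITH AN EXPLICIT SECOND-ORDER REMAINDER**: if the coordinate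
gradient is `K`-Lipschitz in the matrix sup norm, `‖D^ε S(W) − D^ε S(W')‖ ≤ K‖coeConfig W − coeConfig W'‖`,
then `|S(e_ε(p)·V) − S(V) − Σ_l ⟪D^ε S(V)_l, p_l⟫| ≤ 4|ε|·K·‖p‖·Σ_l‖p_l‖` — over one leapfrog drift the
potential deviates from its linearisation by `O(ε²)` once `K = O(ε)` (§1: the drift moves the field by
`≤ 8|ε|‖p‖`). -/
theorem abs_action_su2ExpDrift_sub_linear_le (S : (ι → Matrix.specialUnitaryGroup (Fin 2) ℂ) → ℝ) (ε : ℝ)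
    (hd : ∀ W : ι → Matrix.specialUnitaryGroup (Fin 2) ℂ,
      DifferentiableAt ℝ (fun a : ι → EuclideanSpace ℝ (Fin 3) => S (su2ExpDrift ε a * W)) 0)
    {K : ℝ} (hK0 : 0 ≤ K)
    (hK : ∀ W W' : ι → Matrix.specialUnitaryGroup (Fin 2) ℂ,
      ‖(fun l : ι => WithLp.toLp 2 (fun i : Fin 3 => fderiv ℝ (fun a : ι → EuclideanSpace ℝ (Fin 3) => S (su2ExpDrift ε a * W)) 0
          (Pi.single l (EuclideanSpace.single i (1 : ℝ))))) -
        (fun l : ι => WithLp.toLp 2 (fun i : Fin 3 => fderiv ℝ (fun a : ι → EuclideanSpace ℝ (Fin 3) => S (su2ExpDrift ε a * W')) 0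
          (Pi.single l (EuclideanSpace.single i (1 : ℝ)))))‖ ≤ K * ‖coeConfig W - coeConfig W'‖)
    (V : ι → Matrix.specialUnitaryGroup (Fin 2) ℂ) (p : ι → EuclideanSpace ℝ (Fin 3)) :
    |S (su2ExpDrift ε p * V) - S V -
        ∑ l, ⟪WithLp.toLp 2 (fun i : Fin 3 => fderiv ℝ (fun a : ι → EuclideanSpace ℝ (Fin 3) => S (su2ExpDrift ε a * V)) 0
          (Pi.single l (EuclideanSpace.single i (1 : ℝ)))), p l⟫_ℝ| ≤ 4 * |ε| * K * ‖p‖ * ∑ l, ‖p l‖ := by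
  -- the path, its derivative φ and φ's Lipschitz constant
  set f : ℝ → ℝ := fun t => S (su2ExpDrift ε (t • p) * V) with hf
  set φ : ℝ → ℝ := fun t => ∑ l, ⟪WithLp.toLp 2 (fun i : Fin 3 => fderiv ℝ (fun a : ι → EuclideanSpace ℝ (Fin 3) =>
          S (su2ExpDrift ε a * (su2ExpDrift ε (t • p) * V))) 0 (Pi.single l (EuclideanSpace.single i (1 : ℝ)))), p l⟫_ℝ with hφ
  set Lφ : ℝ := 8 * |ε| * K * ‖p‖ * ∑ l, ‖p l‖ with hL
  have hderiv : ∀ t, HasDerivAt f (φ t) t := fun t => hasDerivAt_action_su2ExpDrift S ε hd V p t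
  have hLip : ∀ t t' : ℝ, |φ t - φ t'| ≤ Lφ * |t - t'| := by
    intro t t'
    rw [hφ]
    simp only
    rw [← Finset.sum_sub_distrib]
    refine (Finset.abs_sum_le_sum_abs _ _).trans ?_
    have hdist := norm_coeConfig_su2ExpDrift_sub_le ε V p t t'
    have hKtt := (hK (su2ExpDrift ε (t • p) * V) (su2ExpDrift ε (t' • p) * V)).trans (mul_le_mul_of_nonneg_left hdist hK0)
    calc ∑ l, |⟪WithLp.toLp 2 (fun i : Fin 3 => fderiv ℝ (fun a : ι → EuclideanSpace ℝ (Fin 3) =>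
              S (su2ExpDrift ε a * (su2ExpDrift ε (t • p) * V))) 0 (Pi.single l (EuclideanSpace.single i (1 : ℝ)))), p l⟫_ℝ -
            ⟪WithLp.toLp 2 (fun i : Fin 3 => fderiv ℝ (fun a : ι → EuclideanSpace ℝ (Fin 3) =>
              S (su2ExpDrift ε a * (su2ExpDrift ε (t' • p) * V))) 0 (Pi.single l (EuclideanSpace.single i (1 : ℝ)))), p l⟫_ℝ|
        ≤ ∑ l, (K * (8 * |ε| * ‖p‖ * |t - t'|)) * ‖p l‖ := by
          refine Finset.sum_le_sum fun l _ => ?_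
          rw [← inner_sub_left]
          refine (abs_real_inner_le_norm _ _).trans (mul_le_mul_of_nonneg_right ?_ (norm_nonneg _))
          refine le_trans ?_ hKtt
          exact norm_le_pi_norm ((fun l : ι => WithLp.toLp 2 (fun i : Fin 3 => fderiv ℝ (fun a : ι → EuclideanSpace ℝ (Fin 3) =>
              S (su2ExpDrift ε a * (su2ExpDrift ε (t • p) * V))) 0 (Pi.single l (EuclideanSpace.single i (1 : ℝ))))) -
            (fun l : ι => WithLp.toLp 2 (fun i : Fin 3 => fderiv ℝ (fun a : ι → EuclideanSpace ℝ (Fin 3) =>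
              S (su2ExpDrift ε a * (su2ExpDrift ε (t' • p) * V))) 0 (Pi.single l (EuclideanSpace.single i (1 : ℝ)))))) l
      _ = Lφ * |t - t'| := by rw [hL, ← Finset.mul_sum]; ring
  have hL0 : 0 ≤ Lφ := by rw [hL]; positivity
  -- values at the endpoints
  have hf0 : f 0 = S V := by
    rw [hf]
    simp only [zero_smul, su2ExpDrift_zero, one_mul]
  have hf1 : f 1 = S (su2ExpDrift ε p * V) := by
    rw [hf]
    simp only [one_smul]
  have hφ0 : φ 0 = ∑ l, ⟪WithLp.toLp 2 (fun i : Fin 3 => fderiv ℝ (fun a : ι → EuclideanSpace ℝ (Fin 3) => S (su2ExpDrift ε a * V)) 0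
          (Pi.single l (EuclideanSpace.single i (1 : ℝ)))), p l⟫_ℝ := by
    rw [hφ]
    simp only [zero_smul, su2ExpDrift_zero, one_mul]
  -- comparison functions G (upper) and H (lower)
  have hG : ∀ t, HasDerivAt (fun x => f x - x * φ 0 - Lφ / 2 * (x * x)) (φ t - φ 0 - Lφ * t) t := by
    intro t
    have h1 := ((hderiv t).sub (hasDerivAt_mul_const (φ 0))).sub
      (((hasDerivAt_id' t).mul (hasDerivAt_id' t)).const_mul (Lφ / 2))
    exact h1.congr_deriv (by ring)
  have hH : ∀ t, HasDerivAt (fun x => f x - x * φ 0 + Lφ / 2 * (x * x)) (φ t - φ 0 + Lφ * t) t := by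
    intro t
    have h1 := ((hderiv t).sub (hasDerivAt_mul_const (φ 0))).add
      (((hasDerivAt_id' t).mul (hasDerivAt_id' t)).const_mul (Lφ / 2))
    exact h1.congr_deriv (by ring)
  have hGmono : (fun x => f x - x * φ 0 - Lφ / 2 * (x * x)) 1 - (fun x => f x - x * φ 0 - Lφ / 2 * (x * x)) 0 ≤ 0 * (1 - 0) := by
    refine (convex_Icc (0 : ℝ) 1).image_sub_le_mul_sub_of_deriv_le
      (fun t _ => (hG t).continuousAt.continuousWithinAt) (fun t _ => (hG t).differentiableAt.differentiableWithinAt)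
      (fun t ht => ?_) 0 (left_mem_Icc.2 zero_le_one) 1 (right_mem_Icc.2 zero_le_one) zero_le_one
    rw [interior_Icc] at ht
    rw [(hG t).deriv]
    have := hLip t 0
    rw [sub_zero, abs_of_pos ht.1] at this
    linarith [le_abs_self (φ t - φ 0)]
  have hHmono : 0 * (1 - 0) ≤ (fun x => f x - x * φ 0 + Lφ / 2 * (x * x)) 1 - (fun x => f x - x * φ 0 + Lφ / 2 * (x * x)) 0 := by
    refine (convex_Icc (0 : ℝ) 1).mul_sub_le_image_sub_of_le_deriv
      (fun t _ => (hH t).continuousAt.continuousWithinAt) (fun t _ => (hH t).differentiableAt.differentiableWithinAt)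
      (fun t ht => ?_) 0 (left_mem_Icc.2 zero_le_one) 1 (right_mem_Icc.2 zero_le_one) zero_le_one
    rw [interior_Icc] at ht
    rw [(hH t).deriv]
    have := hLip t 0
    rw [sub_zero, abs_of_pos ht.1] at this
    linarith [neg_abs_le (φ t - φ 0)]
  norm_num at hGmono hHmono
  rw [← hf1, ← hf0, ← hφ0, abs_le]
  have hL2 : Lφ / 2 = 4 * |ε| * K * ‖p‖ * ∑ l, ‖p l‖ := by rw [hL]; ring
  constructor <;> linarith [hGmono, hHmono]

end Work

end Summit.Ventures.LatticeQCDFlow.Exactness
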